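import Summits.AtomisticToContinuum.Crystallization.Theorems.FrustratedLawDichotomyCellArithNash
import Summits.AtomisticToContinuum.Crystallization.Theorems.FrustratedLawDichotomyCellData

/-!
# FrustratedLawDichotomy · crux `AperiodicFrustratedLawGap` (stmt-AtomisticToContinuum-27623) — CELL-ARITH, the NORM WITNESSES of the
# multiplier columns from DECIDABLE RATIONAL facts (decomp-a2c hand-1 g53; KFILE-FORMAT ed2 §5 «‖Y‖, ‖Y m − Y m′‖ by norm_le_of_nearId»,
# §6 kernel MUSTs «no per-label norm_num» — so every real hypothesis here is the cast of ONE rational comparison a table `decide`s)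

On a near-identity cell `|FᵀF − 1| ≤ ε` with label-frame multipliers `Y m = posL F (ω m)` (lens-5 AMEND l.9363), rational `ω = cast ∘ ωq`,
`ε = cast εq`:
* `norm_posL_le_ratWitness` — `(1 + 3εq)·Σ (vq i)² ≤ yb²`, `0 ≤ yb` (in `ℚ`) ⇒ `‖posL F v‖ ≤ yb` ((260) `norm_le_of_nearId`);
* `sum_norm_le_ratWitness` — the (251) `hSY` number: `Σ_{MI} ‖Y x‖ ≤ Σ_{MI} yb x` from the per-label witnesses, and its reading
  `le_SY_reading` (`S·Σ‖Y‖ ≤ Σ ⌈S·yb⌉`);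
* `YE_sub_eq_posL` — `YE MI Y m − YE MI Y m' = posL F (ωE m − ωE m')` with `ωE = if · ∈ MI then ω · else 0`, so `‖YE m − YE m'‖` (the `RM`
  column's factor, `…CellArithNash.rmTerm_le`'s `a ≤ yb`) is again `norm_posL_le_ratWitness` on the rational difference;
* `farColEntry_le` — the (251) `hfc` entry assembled: `‖Y m‖·farCol (Rc − (‖pos m‖ + τ)) ≤ yb·farColQ (Rc − (ρ + τ))` from the two
  rational witnesses `yb` (multiplier) and `ρ` (site norm, `(1 + 3εq)|aq m|² ≤ ρ²`) and `0 < Rc − (ρ + τ)` (`…CellArithTaylor.mul_farCol_le`).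

DEF-FREE; imports `…CellArithNash` + (260) `…CellData`; 0 sorry.  Tags: [folklore].
-/

namespace Summit.AtomisticToContinuum.Crystallization.Theorems.FrustratedLawDichotomyCellArithWitness

open scoped BigOperators
open Summit.AtomisticToContinuum.Crystallization.Theorems.ChargedEnergyGapNegative (E3)
open Summit.AtomisticToContinuum.Crystallization.Theorems.FrustratedLawDichotomyCoherentFloor (farCol)
open Summit.AtomisticToContinuum.Crystallization.Theorems.FrustratedLawDichotomyCellFrame (YE)
open Summit.AtomisticToContinuum.Crystallization.Theorems.FrustratedLawDichotomyCellMetric (posL posL_sub posL_zero)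
open Summit.AtomisticToContinuum.Crystallization.Theorems.FrustratedLawDichotomyCellData (norm_le_of_nearId)
open Summit.AtomisticToContinuum.Crystallization.Theorems.FrustratedLawDichotomyCellArith
open Summit.AtomisticToContinuum.Crystallization.Theorems.FrustratedLawDichotomyCellArithTaylor (farColQ mul_farCol_le)

variable {ι : Type*} [DecidableEq ι]

section NearId

variable {F : Matrix (Fin 3) (Fin 3) ℝ} {ε : ℝ} {εq : ℚ}

omit [DecidableEq ι] in
/-- ★ NORM WITNESS from a rational comparison: `ε = εq`, `v = cast ∘ vq`, `0 ≤ yb`, `(1 + 3εq)·Σ (vq i)² ≤ yb²` ⇒ `‖posL F v‖ ≤ yb`. [folklore] -/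
theorem norm_posL_le_ratWitness (hG : ∀ i j, |(F.transpose * F) i j - (if i = j then 1 else 0)| ≤ ε) (hε : ε = (εq : ℝ))
    {v : Fin 3 → ℝ} {vq : Fin 3 → ℚ} (hv : ∀ i, v i = (vq i : ℝ)) {yb : ℚ} (hyb : 0 ≤ yb)
    (hw : (1 + 3 * εq) * ∑ i, vq i ^ 2 ≤ yb ^ 2) : ‖posL F v‖ ≤ (yb : ℝ) := by
  refine norm_le_of_nearId hG (by exact_mod_cast hyb) ?_
  have hw' : (((1 + 3 * εq) * ∑ i, vq i ^ 2 : ℚ) : ℝ) ≤ ((yb ^ 2 : ℚ) : ℝ) := Rat.cast_le.2 hw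
  have e : ∑ i, v i ^ 2 = ∑ i, ((vq i : ℚ) : ℝ) ^ 2 := Finset.sum_congr rfl fun i _ => by rw [hv i]
  rw [e, hε]; push_cast at hw' ⊢; exact hw'

omit [DecidableEq ι] in
/-- ★ THE (251) `hSY` NUMBER: per-label rational witnesses sum to a bound of `Σ_{MI} ‖Y x‖`. [folklore] -/
theorem sum_norm_le_ratWitness (hG : ∀ i j, |(F.transpose * F) i j - (if i = j then 1 else 0)| ≤ ε) (hε : ε = (εq : ℝ))
    (MI : Finset ι) {ω : ι → Fin 3 → ℝ} {ωq : ι → Fin 3 → ℚ} (hω : ∀ x i, ω x i = (ωq x i : ℝ)) (yb : ι → ℚ)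
    (hyb : ∀ x ∈ MI, 0 ≤ yb x) (hw : ∀ x ∈ MI, (1 + 3 * εq) * ∑ i, ωq x i ^ 2 ≤ yb x ^ 2) :
    ∑ x ∈ MI, ‖posL F (ω x)‖ ≤ ((∑ x ∈ MI, yb x : ℚ) : ℝ) := by
  push_cast
  exact Finset.sum_le_sum fun x hx => norm_posL_le_ratWitness hG hε (hω x) (hyb x hx) (hw x hx)

omit [DecidableEq ι] in
/-- the `SY` number read at scale `S`: `S·Σ_{MI} ‖Y x‖ ≤ Σ_{MI} ⌈S·yb x⌉` (so `SY := (Σ rdHi S (yb x))/S`). [folklore] -/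
theorem le_SY_reading {S : ℤ} (hS : 0 ≤ S) (hG : ∀ i j, |(F.transpose * F) i j - (if i = j then 1 else 0)| ≤ ε)
    (hε : ε = (εq : ℝ)) (MI : Finset ι) {ω : ι → Fin 3 → ℝ} {ωq : ι → Fin 3 → ℚ} (hω : ∀ x i, ω x i = (ωq x i : ℝ))
    (yb : ι → ℚ) (hyb : ∀ x ∈ MI, 0 ≤ yb x) (hw : ∀ x ∈ MI, (1 + 3 * εq) * ∑ i, ωq x i ^ 2 ≤ yb x ^ 2) :
    S * ∑ x ∈ MI, ‖posL F (ω x)‖ ≤ ((∑ x ∈ MI, rdHi S (yb x) : ℤ) : ℝ) := by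
  refine Summit.AtomisticToContinuum.Crystallization.Theorems.FrustratedLawDichotomyCellArithGram.le_finsetSum_readings S MI _ _
    fun x hx => ?_
  exact (mul_le_mul_of_nonneg_left (norm_posL_le_ratWitness hG hε (hω x) (hyb x hx) (hw x hx)) (by exact_mod_cast hS)).trans
    (le_rdHi S (yb x))

/-- ★ the `RM` column's norm factor in the label frame: `YE MI Y m − YE MI Y m' = posL F (ωE m − ωE m')`, `ωE = MI.indicator ω`
written as an `if`. [folklore] -/
theorem YE_sub_eq_posL (MI : Finset ι) (ω : ι → Fin 3 → ℝ) (m m' : ι) :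
    YE MI (fun x => posL F (ω x)) m - YE MI (fun x => posL F (ω x)) m'
      = posL F ((if m ∈ MI then ω m else 0) - (if m' ∈ MI then ω m' else 0)) := by
  unfold YE
  rw [posL_sub]
  by_cases h1 : m ∈ MI <;> by_cases h2 : m' ∈ MI <;> simp [h1, h2, posL_zero]

/-- ★ `‖YE m − YE m'‖ ≤ yb` from ONE rational comparison on the difference of the (extended) rational multipliers. [folklore] -/
theorem norm_YE_sub_le_ratWitness (hG : ∀ i j, |(F.transpose * F) i j - (if i = j then 1 else 0)| ≤ ε) (hε : ε = (εq : ℝ))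
    (MI : Finset ι) {ω : ι → Fin 3 → ℝ} {ωq : ι → Fin 3 → ℚ} (hω : ∀ x i, ω x i = (ωq x i : ℝ)) (m m' : ι) {yb : ℚ}
    (hyb : 0 ≤ yb)
    (hw : (1 + 3 * εq) * ∑ i, ((if m ∈ MI then ωq m i else 0) - (if m' ∈ MI then ωq m' i else 0)) ^ 2 ≤ yb ^ 2) :
    ‖YE MI (fun x => posL F (ω x)) m - YE MI (fun x => posL F (ω x)) m'‖ ≤ (yb : ℝ) := by
  rw [YE_sub_eq_posL]
  refine norm_posL_le_ratWitness hG hε (vq := fun i => (if m ∈ MI then ωq m i else 0) - (if m' ∈ MI then ωq m' i else 0))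
    (fun i => ?_) hyb hw
  by_cases h1 : m ∈ MI <;> by_cases h2 : m' ∈ MI <;> simp [h1, h2, hω]

/-- ★ THE (251) `hfc` ENTRY assembled from rational witnesses: multiplier norm `yb`, site norm `ρ`, clearance `0 < Rc − (ρ + τ)`. [folklore] -/
theorem farColEntry_le (hG : ∀ i j, |(F.transpose * F) i j - (if i = j then 1 else 0)| ≤ ε) (hε : ε = (εq : ℝ))
    {y am : Fin 3 → ℝ} {yq aq : Fin 3 → ℚ} (hy : ∀ i, y i = (yq i : ℝ)) (ha : ∀ i, am i = (aq i : ℝ)) {yb ρ τ Rc : ℚ}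
    (hyb : 0 ≤ yb) (hwy : (1 + 3 * εq) * ∑ i, yq i ^ 2 ≤ yb ^ 2) (hρ : 0 ≤ ρ) (hwa : (1 + 3 * εq) * ∑ i, aq i ^ 2 ≤ ρ ^ 2)
    (hpos : 0 < Rc - (ρ + τ)) :
    ‖posL F y‖ * farCol ((Rc : ℝ) - (‖posL F am‖ + (τ : ℝ))) ≤ ((yb * farColQ (Rc - (ρ + τ)) : ℚ) : ℝ) :=
  mul_farCol_le (norm_nonneg _) (norm_posL_le_ratWitness hG hε hy hyb hwy) (norm_posL_le_ratWitness hG hε ha hρ hwa) hpos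

end NearId

end Summit.AtomisticToContinuum.Crystallization.Theorems.FrustratedLawDichotomyCellArithWitness
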